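import Literature.MathematicalPhysics.QuantumLattice.HeisenbergEnergyDensity
import HarnessLib

/-!
# Ventures/CertifiedManyBodySolver — Transport/LTIDualSpinChain.lean

HONEST FRAMING: first certified bounds; not a superconductivity verdict; every number certified or labelled float.

LANE-B TRANSPORT, STEP r72(1) (lead D-18 r72; LEAN-MAP §6 R7 = G8; SOUNDNESS-ltisdp.md S1–S4/S7, Heisenberg case):
the DUAL of the pure `lti(n)` relaxation of a spin chain — "find `E`, a Hermitian multiplier `Λ` for the local-translation-
invariance row `Tr₁ ρ = Tr_n ρ` and a positive semidefinite slack `W` with `h₁₂ ⊗ 1 − E·1 = W + (T(Λ) − Λ)`" — is a WINDOW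
CERTIFICATE in the sense of the tree (`HeisenbergWindowCertificate.lean`): ONE positive block on the whole window and ONE
translation row. This file records that observation as theorems, so that a signed lane-B `lti(n)` row whose dual is exported in
operator form is transported BY NAME exactly like the lane-A window rows:

* `gramForm_single_eq` — any window matrix `W` is the Gram form `gramForm W (fun i => single i₀ i 1)` over matrix units, so a PSD
  block given AS A MATRIX fits the `gramForm Λm O` slot of the window theorems;
* `lti_dual_ringEnergy_ge` — the LTI dual identity on a window `Λ' ⊂ ℤ` (energy density `J 𝐒₀·𝐒₁`, slack `W ⪰ 0` on `Λ'`,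
  multiplier `Y` on an inner region `Λ` whose unit translate lies in `Λ'`) gives `E · L ≤ E₀(H_L)` for EVERY ring `ℤ/Lℤ`, `L ≥ 3`,
  on which the window projects injectively — the finite-ring statement of SOUNDNESS-ltisdp S2–S4 (no uniqueness, any `L`);
* `lti_dual_energyDensity_ge` — hence `E ≤ heisenbergEnergyDensity n 1 J` (`J ≥ 0`), the thermodynamic-limit row (S7).

All three are thin corollaries of `heisenbergChain_groundEnergy_ge_of_window_certificate` /
`heisenbergEnergyDensity_one_ge_of_window_certificate` [cite: Han2020Bootstrap, §2] with the commutator, charge, anti-Hermitian and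
contraction families EMPTY. What this does NOT cover (LEAN-MAP §6 R7, laneB_sources §8(b)): (i) the by-value link from the ltisdp
readers' generic conic statement (certsdp-problem/0) to this operator identity — the certificate must be exported as `(E, Y, W)`
(BOARD D-10); (ii) the coarse-grained `mps(n,D,A)` relaxation of Kull–Schuch–Dive–Navascués [cite: KullEtAl2024, §2.5] whose
pulled-back window object is not writable at `n ≈ 40–60` — THEOREM B of R7; (iii) fermions (the Hubbard analogue rides on
`hubbardChain_energyPerSite_ge_of_window_certificate` the same way; separate file).
-/

noncomputable section

namespace Summit.Ventures.CertifiedManyBodySolver.Transport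

open Matrix Finset
open Literature.Probability.LatticeModels
open Literature.MathematicalPhysics.QuantumLattice
open Literature.MathematicalPhysics.QuantumManyBody.StateRelaxation
open scoped ComplexOrder BigOperators

/-- **A matrix is the Gram form of its own entries over matrix units**: with `O i := single i₀ i 1` (the unit taking the basis
vector `i` to a fixed `i₀`), `gramForm W O = Σᵢⱼ W i j • (O i)ᴴ O j = Σᵢⱼ W i j • single i j 1 = W`. So a positive semidefinite
window block handed over AS A MATRIX (an LTI dual slack, an N-representability block) fits the `gramForm Λm O` slot of the tree's
window-certificate theorems with `Λm := W`. [folklore] -/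
theorem gramForm_single_eq {ι : Type*} [Fintype ι] [DecidableEq ι] (W : Matrix ι ι ℂ) (i₀ : ι) :
    gramForm W (fun i => Matrix.single i₀ i (1 : ℂ)) = W := by
  unfold gramForm
  conv_rhs => rw [Matrix.matrix_eq_sum_single W]
  refine Finset.sum_congr rfl fun i _ => Finset.sum_congr rfl fun j _ => ?_
  rw [Matrix.star_eq_conjTranspose, Matrix.conjTranspose_single, star_one, Matrix.single_mul_single_same,
    one_mul, Matrix.smul_single, smul_eq_mul, mul_one]

variable {L : ℕ} [NeZero L]

/-- **LTI dual ⇒ energy of every long Heisenberg ring (SOUNDNESS-ltisdp S2–S4, spin case; lead D-18 r72 step 1).**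
Data: a window `Λ' ⊂ ℤ` containing `0, 1`, an inner region `Λ ⊆ Λ'` whose lattice neighbours lie in `Λ'` and whose unit translate
`Λ + 1` lies in `Λ'`; a slack `W ⪰ 0` in the window algebra `Op ↥Λ' (n+1)` and a multiplier `Y ∈ Op ↥Λ (n+1)`; the LTI DUAL IDENTITY
`J 𝐒₀·𝐒₁ − E·1 = W + (Γ(Λ+1 ↪ Λ')(shift Y) − Γ(Λ ↪ Λ') Y)`. Then for every ring length `L ≥ 3` with `x ↦ x mod L` injective on `Λ'`:
`E · L ≤ E₀(H_L)`, `H_L = J Σ_{bonds of ℤ/Lℤ} 𝐒_x·𝐒_y`. No uniqueness or closed-shell hypothesis: the window theorem evaluates the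
identity in the translation average of an arbitrary ground state. [cite: Han2020Bootstrap, §2] -/
theorem lti_dual_ringEnergy_ge (n : ℕ) (J : ℝ) (hL : 3 ≤ L)
    {Λ Λ' : Finset (Site 1)} (hΛ : Λ ⊆ Λ')
    (hclosed : ∀ x ∈ Λ, ∀ i : Fin 1, x + unitVec i ∈ Λ' ∧ x - unitVec i ∈ Λ')
    (hz : (0 : Site 1) ∈ Λ') (he : (unitVec 0 : Site 1) ∈ Λ')
    (hInj : Set.InjOn (Torus.proj (d := 1) L) ↑Λ')
    (hsh : affShiftSet 1 (unitVec 0) Λ ⊆ Λ')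
    (W : Op ↥Λ' (n + 1)) (hW : W.PosSemidef) (Y : Op ↥Λ (n + 1)) {E : ℝ}
    (hcert : (J : ℂ) • spinDot n (⟨0, hz⟩ : ↥Λ') ⟨unitVec 0, he⟩ - (E : ℂ) • (1 : Op ↥Λ' (n + 1)) =
      W + (spinEmbed (siteIncl hsh) (spinEmbed (siteAffEmb 1 (unitVec 0) Λ) Y) - spinEmbed (siteIncl hΛ) Y)) :
    E * L ≤ (heisenbergHamiltonian n (torusGraph 1 L) J).groundEnergy := by
  classical
  have key := heisenbergChain_groundEnergy_ge_of_window_certificate n J hL hΛ hclosed hz he hInj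
    (Λm := W) hW (fun i => Matrix.single (fun _ => (0 : Fin (n + 1))) i (1 : ℂ))
    (∅ : Finset (Fin 0)) (fun _ => 0)
    ({()} : Finset Unit) (fun _ => 1) (fun _ => unitVec 0) (fun _ => hsh) (fun _ => Y)
    (∅ : Finset (Fin 0)) (fun _ => 0) (fun _ => 0) (fun _ => 1)
    (fun j hj => absurd hj (Finset.notMem_empty j)) (fun j hj => absurd hj (Finset.notMem_empty j))
    (∅ : Finset (Fin 0)) (fun _ => 0) (fun _ => 0)
    (∅ : Finset (Fin 0)) (fun _ => 0) (fun _ => 0) (fun k hk => absurd hk (Finset.notMem_empty k))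
    (c := E) (by
      rw [gramForm_single_eq, hcert]
      simp only [Finset.sum_empty, Finset.sum_singleton, zero_add, add_zero])
  simpa using key

/-- **Per-site form**: `E ≤ E₀(H_L)/L` for every such ring (the shape of the bundle's ring-wise rows). [cite: Han2020Bootstrap, §2] -/
theorem lti_dual_ringEnergy_div_ge (n : ℕ) (J : ℝ) (hL : 3 ≤ L)
    {Λ Λ' : Finset (Site 1)} (hΛ : Λ ⊆ Λ')
    (hclosed : ∀ x ∈ Λ, ∀ i : Fin 1, x + unitVec i ∈ Λ' ∧ x - unitVec i ∈ Λ')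
    (hz : (0 : Site 1) ∈ Λ') (he : (unitVec 0 : Site 1) ∈ Λ')
    (hInj : Set.InjOn (Torus.proj (d := 1) L) ↑Λ')
    (hsh : affShiftSet 1 (unitVec 0) Λ ⊆ Λ')
    (W : Op ↥Λ' (n + 1)) (hW : W.PosSemidef) (Y : Op ↥Λ (n + 1)) {E : ℝ}
    (hcert : (J : ℂ) • spinDot n (⟨0, hz⟩ : ↥Λ') ⟨unitVec 0, he⟩ - (E : ℂ) • (1 : Op ↥Λ' (n + 1)) =
      W + (spinEmbed (siteIncl hsh) (spinEmbed (siteAffEmb 1 (unitVec 0) Λ) Y) - spinEmbed (siteIncl hΛ) Y)) :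
    E ≤ (heisenbergHamiltonian n (torusGraph 1 L) J).groundEnergy / (L : ℝ) := by
  have hL0 : (0 : ℝ) < L := by exact_mod_cast (show 0 < L by omega)
  rw [le_div_iff₀ hL0]
  exact lti_dual_ringEnergy_ge n J hL hΛ hclosed hz he hInj hsh W hW Y hcert

omit [NeZero L] in
/-- **LTI dual ⇒ thermodynamic-limit energy density (SOUNDNESS-ltisdp S7, spin case).** With the data of `lti_dual_ringEnergy_ge`
and `J ≥ 0`: `E ≤ heisenbergEnergyDensity n 1 J` (the TL object of `HeisenbergEnergyDensity.lean`; the injectivity of `x ↦ x mod L`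
on `Λ'` holds for all large `L`, `exists_forall_le_injOn_proj`). This is the by-name transport for a lane-B `lti(n)` row whose
certificate is exported as the operator triple `(E, Y, W)`. [cite: Han2020Bootstrap, §2] [cite: KullEtAl2024, §6.2] -/
theorem lti_dual_energyDensity_ge (n : ℕ) {J : ℝ} (hJ : 0 ≤ J)
    {Λ Λ' : Finset (Site 1)} (hΛ : Λ ⊆ Λ')
    (hclosed : ∀ x ∈ Λ, ∀ i : Fin 1, x + unitVec i ∈ Λ' ∧ x - unitVec i ∈ Λ')
    (hz : (0 : Site 1) ∈ Λ') (he : (unitVec 0 : Site 1) ∈ Λ')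
    (hsh : affShiftSet 1 (unitVec 0) Λ ⊆ Λ')
    (W : Op ↥Λ' (n + 1)) (hW : W.PosSemidef) (Y : Op ↥Λ (n + 1)) {E : ℝ}
    (hcert : (J : ℂ) • spinDot n (⟨0, hz⟩ : ↥Λ') ⟨unitVec 0, he⟩ - (E : ℂ) • (1 : Op ↥Λ' (n + 1)) =
      W + (spinEmbed (siteIncl hsh) (spinEmbed (siteAffEmb 1 (unitVec 0) Λ) Y) - spinEmbed (siteIncl hΛ) Y)) :
    E ≤ heisenbergEnergyDensity n 1 J := by
  classical
  have key := heisenbergEnergyDensity_one_ge_of_window_certificate n hJ hΛ hclosed hz he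
    (Λm := W) hW (fun i => Matrix.single (fun _ => (0 : Fin (n + 1))) i (1 : ℂ))
    (∅ : Finset (Fin 0)) (fun _ => 0)
    ({()} : Finset Unit) (fun _ => 1) (fun _ => unitVec 0) (fun _ => hsh) (fun _ => Y)
    (∅ : Finset (Fin 0)) (fun _ => 0) (fun _ => 0) (fun _ => 1)
    (fun j hj => absurd hj (Finset.notMem_empty j)) (fun j hj => absurd hj (Finset.notMem_empty j))
    (∅ : Finset (Fin 0)) (fun _ => 0) (fun _ => 0)
    (∅ : Finset (Fin 0)) (fun _ => 0) (fun _ => 0) (fun k hk => absurd hk (Finset.notMem_empty k))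
    (c := E) (by
      rw [gramForm_single_eq, hcert]
      simp only [Finset.sum_empty, Finset.sum_singleton, zero_add, add_zero])
  simpa using key

end Summit.Ventures.CertifiedManyBodySolver.Transport
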